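import Summits.CriticalPhenomena.PercolationContinuityZ3.Theorems.FK.Transplant.KNFreePinningLawFK
import Summits.CriticalPhenomena.PercolationContinuityZ3.Theorems.FK.Transplant.FHBoundaryReachTools
import HarnessLib

/-!
# FRONTIER TRANSPLANT, binder 2 (TP_FK) research line R-TP: sequential free trials for INCREASING region-determined events,
# FKG for `fkLaw`, placed-slab two-point bounds, first-moment pooling — the law-abstract tools of the slab Step IV (R-TP-NOTE-g183)

Support file (`--supports stmt-CriticalPhenomena-4575`, helper) of the FRONTIER TRANSPLANT sub-cell (`fk-continuity/transplant/`,
seat `prim-bschramm-fkt-p1`); builds on p205010 (kernel theorem, internal audit signed; external expert review pending).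
0 definitions · 0 named facts · 0 sorries · standard axioms. File 2/18 of the bytes-first package (R60 (3)(β)) of the
UNFUNDED memo row `T4-SLAB [g122, R60]` (re-described R62 (E)); proposable only on a coordinator ruling.
Registered R63 (cell INBOX l.4709, 2026-08-23); registry row T4s; lead label T4s-02 (fkt-lead L22, l.4677).

HONEST FRAMING (page 1, cell rule). The transplant's theorem of record `ufsc0_of_freeBoundaryHypothesis_r3`
(p248245) is CONDITIONAL on FH AND on TP_FK = `KNFreeTargetHittable d q p`, both OPEN at the same `p` for `q > 1`
near `p_c(q)` (⇔ GRC Conj. (5.103) via K1; barrier note `Literature.Barriers.CriticalPhenomena.SamePFreeBoundaryCriteria`,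
FBN-01, cited first); the transplant is a typed reduction, not a proof of FK continuity. THIS FILE is unconditional,
law-abstract infrastructure (every `q ≥ 1`, every finite piece `Λ`, every weighting): it proves nothing about either
binder and says nothing at `p ↓ p_c(q)`.

* `fkLaw_real_biInter_compl_le_pow` / `one_sub_pow_le_fkLaw_real_biUnion` — SEQUENTIAL FREE TRIALS in disjoint regions
  for arbitrary INCREASING region-determined events (`μ(⋂ A_iᶜ) ≤ (1-α)^n`, `μ(⋃ A_i) ≥ 1 - (1-α)^n` under `fkLaw Q W q`
  when the free law of `S_i` alone gives `A_i` probability `≥ α` and `W ≥ lattW p` on the pairs of `S_i`): Grimmett's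
  coupling (proof of Thm. (5.104), (5.113)–(5.116)) — conditioning on the earlier regions is pinning (Thm. (3.7),
  `isPinningLaw_fkLaw`), the pinned weighting dominates `restrW S_j (lattW p)` ((3.22)), Λ-independence (Lemma (4.13));
  generalises T1s-A's `one_sub_pow_le_fkLaw_real_linkIn` (fkt-p2, p342086; connection events), same proof.
* (FKG for `fkLaw` is T1b-A's `fkLaw_fkg`, fkt-p3, imported) `fkLaw_real_openConnIn_ge_mul` — `φ(u ↔ z in S) ≥ φ(c ↔ u in S)·φ(c ↔ z in S)`;
  `exists_forall_le_fkLaw_image_fkSlab_real_openConnIn` — with FBN-01's `FKSlabPercolation d p q L` (slab connectivities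
  from the CENTRE `> α`) any two points of any PLACED slab copy `g(S(L,N))` are joined inside it with free-law
  probability `≥ α²` (transport = T1s-A, fkt-p2, imported).
* `half_le_measureReal_half_mul_le_card` — FIRST-MOMENT POOLING under any probability measure: events `E_0..E_{n-1}` of
  probability `≥ β` each ⇒ with probability `≥ β/2` at least `βn/2` occur; `one_sub_pow_le_fkLaw_real_exists_fanOut` —
  the composition (pooling inside each sub-plate, sequential trials across sub-plates): the slab Step IV's replacement
  of Kozma–Nitzan's uniqueness zone (Lemma 7) — a relay whose FROZEN shell cluster reaches many of its exits.
* `fkLaw_pinW_real_le_of_inter_localCylinder_subset` — under a pinned law the pinned pairs are frozen a.s. ((N) of the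
  pinning API): `B ∩ [ξ]_F ⊆ A ⇒ φ_ξ(B) ≤ φ_ξ(A)` (the relay inherits the lane's probability).

References: G. Grimmett, *The Random-Cluster Model*, Springer 2006, Thm. (3.7), (3.8), (3.21)/(3.22), Lemma (4.13),
proof of Thm. (5.104) (5.113)–(5.116) [Grimmett2006]; G. Kozma, S. Nitzan, arXiv:2401.12397, §4 Lemmas 7, 10 [KozmaNitzan2024].
-/

noncomputable section

open MeasureTheory
open scoped ENNReal Classical

namespace Summit.CriticalPhenomena.PercolationContinuityZ3.Theorems.FK

open Literature.Probability.Percolation Literature.Probability.LatticeModels SimpleGraph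
open Literature.Probability.Percolation.GadgetSystem Literature.Probability.Percolation.KozmaNitzan Transplant
open Literature.Barriers.CriticalPhenomena

variable {d : ℕ}

/-! ### 1. Sequential free trials in disjoint regions, increasing region-determined events -/

/-- **Sequential free trials, failure form** (`q ≥ 1`). `μ = fkLaw Q W q`; `S_0, …, S_{n-1} ⊆ Q` pairwise DISJOINT,
`lattW p ≤ W` on their inside pairs; `A_i` increasing, measurable, determined by the pairs inside `S_i`, of probability
`≥ α` under the FREE law of `S_i` alone. Then `μ(⋂_{i<n} A_iᶜ) ≤ (1-α)^n` (given any pattern of the earlier regions the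
conditional law is the pinned law, Thm. (3.7), whose weights dominate `restrW S_j (lattW p)`; (3.22) + Λ-independence).
[cite: Grimmett2006, Thm. (5.104) proof, eqs. (5.113)–(5.116) (§5.7); Thm. (3.7) (p. 39); Thm. (3.21) eq. (3.22); Lemma (4.13) (p. 71)] -/
theorem fkLaw_real_biInter_compl_le_pow {q : ℝ} (hq : 1 ≤ q) (p : unitInterval) (Q : Finset (Site d))
    (W : Sym2 (Site d) → unitInterval) {n : ℕ} {S : ℕ → Finset (Site d)} {A : ℕ → Set (BondConfig (Site d))}
    {α : ℝ}
    (hSQ : ∀ i < n, S i ⊆ Q) (hdisj : ∀ i < n, ∀ j < n, i ≠ j → Disjoint (S i) (S j))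
    (hAup : ∀ i < n, IsUpperSet (A i)) (hAm : ∀ i < n, MeasurableSet (A i))
    (hAdet : ∀ i < n, DeterminedBy (A i) (wireSet (↑(S i) : Set (Site d))))
    (hW : ∀ i < n, ∀ e ∈ wireSet (↑(S i) : Set (Site d)), lattW d p e ≤ W e)
    (hα : ∀ i < n, α ≤ (fkLaw (S i) (restrW (↑(S i) : Set (Site d)) (lattW d p)) q).real (A i)) :
    (fkLaw Q W q).real (⋂ i < n, (A i)ᶜ) ≤ (1 - α) ^ n := by
  have hq0 : 0 < q := one_pos.trans_le hq
  haveI : IsProbabilityMeasure (fkLaw Q W q) := isProbabilityMeasure_fkLaw Q W hq0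
  have hL := isPinningLaw_fkLaw Q hq
  set D : Set (Sym2 (Site d)) := Set.range (Sym2.map (Subtype.val : ↥Q → Site d)) with hD
  -- the revealed pair sets `Fp j = ⋃_{i<j} pairsF (S i)`
  set Fp : ℕ → Finset (Sym2 (Site d)) := fun j => (Finset.range j).biUnion fun i => pairsF (S i) with hFp
  have hAdet' : ∀ i < n, DeterminedBy (A i) (↑(pairsF (S i)) : Set (Sym2 (Site d))) := fun i hi => by
    rw [coe_pairsF]; exact hAdet i hi
  have hmemFp : ∀ {j : ℕ} {e : Sym2 (Site d)}, e ∈ Fp j → ∃ i < j, e ∈ wireSet (↑(S i) : Set (Site d)) := by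
    intro j e he
    rw [hFp, Finset.mem_biUnion] at he
    obtain ⟨i, hi, he⟩ := he
    exact ⟨i, Finset.mem_range.1 hi, by rw [← coe_pairsF]; exact Finset.mem_coe.2 he⟩
  have hFpD : ∀ j ≤ n, (↑(Fp j) : Set (Sym2 (Site d))) ⊆ D := by
    intro j hj e he
    obtain ⟨i, hi, hw⟩ := hmemFp (Finset.mem_coe.1 he)
    have hi' : i < n := lt_of_lt_of_le hi hj
    exact wireSet_subset_range_sym2Map Q
      ⟨fun x hx => Finset.mem_coe.2 (hSQ i hi' (Finset.mem_coe.1 (hw.1 x hx))), hw.2⟩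
  -- the chain `P_j = ⋂_{i<j} A_iᶜ`: determined by `Fp j`, probability `≤ (1-α)^j`
  have key : ∀ j ≤ n, DeterminedBy (⋂ i < j, (A i)ᶜ) (↑(Fp j) : Set (Sym2 (Site d))) ∧
      (fkLaw Q W q).real (⋂ i < j, (A i)ᶜ) ≤ (1 - α) ^ j := by
    intro j
    induction j with
    | zero =>
      intro _
      have h0 : (⋂ i < 0, (A i)ᶜ) = Set.univ := by
        ext ω; simp
      rw [h0, pow_zero]
      exact ⟨determinedBy_univ _, measureReal_le_one⟩
    | succ j ih =>
      intro hj
      have hjn : j < n := hj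
      obtain ⟨hdet, hle⟩ := ih hjn.le
      rw [Set.biInter_lt_succ]
      have hmono : (↑(Fp j) : Set (Sym2 (Site d))) ⊆ ↑(Fp (j + 1)) := by
        rw [hFp]
        exact Finset.coe_subset.2
          (Finset.biUnion_subset_biUnion_of_subset_left _ (Finset.range_mono (Nat.le_succ j)))
      have hsub : (↑(pairsF (S j)) : Set (Sym2 (Site d))) ⊆ ↑(Fp (j + 1)) :=
        Finset.coe_subset.2 (Finset.subset_biUnion_of_mem (fun i => pairsF (S i)) (Finset.self_mem_range_succ j))
      refine ⟨(hdet.mono hmono).inter (((hAdet' j hjn).compl).mono hsub), ?_⟩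
      -- `α ≤ 1` (a probability bounds it)
      haveI : IsProbabilityMeasure (fkLaw (S j) (restrW (↑(S j) : Set (Site d)) (lattW d p)) q) :=
        isProbabilityMeasure_fkLaw _ _ hq0
      have hα1 : α ≤ 1 := (hα j hjn).trans measureReal_le_one
      -- the conditional step: given any pattern of the earlier regions, `A_jᶜ` has probability `≤ 1 - α`
      have hstep : ∀ T' ⊆ Fp j, (↑T' : Set (Sym2 (Site d))) ∈ (⋂ i < j, (A i)ᶜ) →
          (fkLaw Q (pinW W ↑(Fp j) ↑T') q).real (A j)ᶜ ≤ 1 - α := by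
        intro T' _ _
        haveI : IsProbabilityMeasure (fkLaw Q (pinW W ↑(Fp j) ↑T') q) := isProbabilityMeasure_fkLaw Q _ hq0
        rw [probReal_compl_eq_one_sub (hAm j hjn)]
        have hVle : ∀ e ∈ D, restrW (↑(S j) : Set (Site d)) (lattW d p) e ≤ pinW W ↑(Fp j) ↑T' e := by
          intro e _
          by_cases hw : e ∈ wireSet (↑(S j) : Set (Site d))
          · have hnot : e ∉ (↑(Fp j) : Set (Sym2 (Site d))) := by
              intro he
              obtain ⟨i, hi, hw'⟩ := hmemFp (Finset.mem_coe.1 he)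
              have hx := Sym2.out_fst_mem e
              exact Finset.disjoint_left.1 (hdisj i (hi.trans hjn) j hjn hi.ne)
                (Finset.mem_coe.1 (hw'.1 _ hx)) (Finset.mem_coe.1 (hw.1 _ hx))
            rw [restrW_apply_of_mem _ hw, pinW_apply_of_not_mem _ _ hnot]
            exact hW j hjn e hw
          · rw [restrW_apply_of_not_mem _ hw]; exact bot_le
        have hm := hL.mono (restrW (↑(S j) : Set (Site d)) (lattW d p)) (pinW W ↑(Fp j) ↑T') hVle (A j)
          (hAup j hjn) (hAm j hjn)
        rw [fkLaw_eq_of_subset (hSQ j hjn) (finSupp_restrW (S j) (lattW d p)) hq0] at hm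
        linarith [hα j hjn]
      calc (fkLaw Q W q).real ((⋂ i < j, (A i)ᶜ) ∩ (A j)ᶜ)
          = (fkLaw Q W q).real ((A j)ᶜ ∩ ⋂ i < j, (A i)ᶜ) := by rw [Set.inter_comm]
        _ ≤ (1 - α) * (fkLaw Q W q).real (⋂ i < j, (A i)ᶜ) :=
            hL.real_inter_le_of_pinW_le W (hFpD j hjn.le) (hAm j hjn).compl hdet hstep
        _ ≤ (1 - α) * (1 - α) ^ j := mul_le_mul_of_nonneg_left hle (by linarith)
        _ = (1 - α) ^ (j + 1) := by ring
  exact (key n le_rfl).2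

/-- **Sequential free trials, success form**: `fkLaw Q W q (⋃_{i<n} A_i) ≥ 1 - (1-α)^n` under the data of
`fkLaw_real_biInter_compl_le_pow` (T1s-A's `one_sub_pow_le_fkLaw_real_linkIn` = the case `A_i = {s_i ↔ t_i in S_i}`).
[cite: Grimmett2006, Thm. (5.104) proof, eqs. (5.113)–(5.116) (§5.7); Thm. (3.7); Thm. (3.21) eq. (3.22)] -/
theorem one_sub_pow_le_fkLaw_real_biUnion {q : ℝ} (hq : 1 ≤ q) (p : unitInterval) (Q : Finset (Site d))
    (W : Sym2 (Site d) → unitInterval) {n : ℕ} {S : ℕ → Finset (Site d)} {A : ℕ → Set (BondConfig (Site d))}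
    {α : ℝ}
    (hSQ : ∀ i < n, S i ⊆ Q) (hdisj : ∀ i < n, ∀ j < n, i ≠ j → Disjoint (S i) (S j))
    (hAup : ∀ i < n, IsUpperSet (A i)) (hAm : ∀ i < n, MeasurableSet (A i))
    (hAdet : ∀ i < n, DeterminedBy (A i) (wireSet (↑(S i) : Set (Site d))))
    (hW : ∀ i < n, ∀ e ∈ wireSet (↑(S i) : Set (Site d)), lattW d p e ≤ W e)
    (hα : ∀ i < n, α ≤ (fkLaw (S i) (restrW (↑(S i) : Set (Site d)) (lattW d p)) q).real (A i)) :
    1 - (1 - α) ^ n ≤ (fkLaw Q W q).real (⋃ i < n, A i) := by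
  have hq0 : 0 < q := one_pos.trans_le hq
  haveI : IsProbabilityMeasure (fkLaw Q W q) := isProbabilityMeasure_fkLaw Q W hq0
  have hfail := fkLaw_real_biInter_compl_le_pow hq p Q W hSQ hdisj hAup hAm hAdet hW hα
  have hmeas : MeasurableSet (⋃ i < n, A i) :=
    MeasurableSet.iUnion fun i => MeasurableSet.iUnion fun hi => hAm i hi
  have hcompl : (⋃ i < n, A i)ᶜ = ⋂ i < n, (A i)ᶜ := by
    ext ω; simp
  have hc := probReal_compl_eq_one_sub (μ := fkLaw Q W q) hmeas
  rw [hcompl] at hc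
  linarith

/-- **Two-point function between arbitrary points from a hub**: for `q ≥ 1` and any region `S`,
`φ(c ↔ u in S) · φ(c ↔ z in S) ≤ φ(u ↔ z in S)` (FKG and transitivity of `↔ in S`). With a slab copy centred at `c`
and FBN-01's `FKSlabPercolation` (`φ⁰_{S(L,N)}(0 ↔ x) > α` for all `x`), any two points of the copy are joined inside
it with free-law probability `≥ α²`. [cite: Grimmett2006, Thm. (3.8); §5.7 eq. (5.102)] -/
theorem fkLaw_real_openConnIn_ge_mul (Λ : Finset (Site d)) (W : Sym2 (Site d) → unitInterval) {q : ℝ}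
    (hq : 1 ≤ q) (S : Set (Site d)) (c u z : Site d) :
    (fkLaw Λ W q).real (openConnIn S c u) * (fkLaw Λ W q).real (openConnIn S c z) ≤
      (fkLaw Λ W q).real (openConnIn S u z) := by
  have hq0 : 0 < q := one_pos.trans_le hq
  haveI : IsProbabilityMeasure (fkLaw Λ W q) := isProbabilityMeasure_fkLaw Λ W hq0
  calc (fkLaw Λ W q).real (openConnIn S c u) * (fkLaw Λ W q).real (openConnIn S c z)
      ≤ (fkLaw Λ W q).real (openConnIn S c u ∩ openConnIn S c z) :=
        fkLaw_fkg Λ W hq (isUpperSet_openConnIn S c u) (isUpperSet_openConnIn S c z)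
          (measurableSet_openConnIn_of_countable S c u) (measurableSet_openConnIn_of_countable S c z)
    _ ≤ (fkLaw Λ W q).real (openConnIn S u z) := by
        refine measureReal_mono (fun ω hω => ?_) (measure_ne_top _ _)
        obtain ⟨⟨hc, hu, hr⟩, ⟨_, hz, hr'⟩⟩ := hω
        exact ⟨hu, hz, hr.symm.trans hr'⟩

/-- **Two-point function between ANY two points of a PLACED slab copy, from FBN-01's `Π(p, L)`** (`q ≥ 1`):
`FKSlabPercolation d p q L` (centre connectivities `> α`) ⇒ for every `N`, lattice automorphism `g` and `u, z ∈ S(L,N)`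
the FREE law of `g(S(L,N))` joins `g u`, `g z` inside the copy with probability `≥ α²` (T1s-A transport + identification,
hub inequality). = the hypothesis `hβ` of `one_sub_pow_le_fkLaw_real_exists_fanOut` for exits inside one copy.
[cite: Grimmett2006, §5.7 eq. (5.102), Thm. (3.8); Severo2024, §1 (slab percolation threshold)] -/
theorem exists_forall_le_fkLaw_image_fkSlab_real_openConnIn {q : ℝ} (hq : 1 ≤ q) {p : unitInterval} {L : ℕ}
    (hSP : FKSlabPercolation d (p : ℝ) q L) :
    ∃ β : ℝ, 0 < β ∧ ∀ (N : ℕ) (g : zdGraph d ≃g zdGraph d) (u z : Site d), u ∈ fkSlab d L N → z ∈ fkSlab d L N →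
      β ≤ (fkLaw ((fkSlab d L N).image g) (restrW (↑((fkSlab d L N).image g) : Set (Site d)) (lattW d p)) q).real
        (openConnIn (↑((fkSlab d L N).image g) : Set (Site d)) (g u) (g z)) := by
  have hq0 : 0 < q := one_pos.trans_le hq
  obtain ⟨α, hα0, hα⟩ := hSP
  refine ⟨α ^ 2, by positivity, fun N g u z hu hz => ?_⟩
  rw [fkLaw_image_iso_restrW_lattW_real_openConnIn g (fkSlab d L N) p hq0 u z]
  have hu' := (hα N ⟨u, hu⟩).le
  have hz' := (hα N ⟨z, hz⟩).le
  rw [← fkLaw_fkSlab_real_openConnIn p hq0 L N ⟨u, hu⟩] at hu'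
  rw [← fkLaw_fkSlab_real_openConnIn p hq0 L N ⟨z, hz⟩] at hz'
  calc α ^ 2 = α * α := sq α
    _ ≤ (fkLaw (fkSlab d L N) (restrW (↑(fkSlab d L N) : Set (Site d)) (lattW d p)) q).real
            (openConnIn (↑(fkSlab d L N) : Set (Site d)) 0 u) *
          (fkLaw (fkSlab d L N) (restrW (↑(fkSlab d L N) : Set (Site d)) (lattW d p)) q).real
            (openConnIn (↑(fkSlab d L N) : Set (Site d)) 0 z) :=
        mul_le_mul hu' hz' hα0.le (hα0.le.trans hu')
    _ ≤ _ := fkLaw_real_openConnIn_ge_mul (fkSlab d L N) _ hq _ 0 u z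

/-! ### 3. First-moment pooling under an arbitrary probability measure -/

section Pooling

variable {Ω : Type*} [MeasurableSpace Ω]

/-- The number of the events `E_0, …, E_{n-1}` that occur, as a real-valued function. [folklore] -/
theorem measurable_card_filter_mem (E : ℕ → Set Ω) (n : ℕ) (hE : ∀ k < n, MeasurableSet (E k)) :
    Measurable fun ω => (((Finset.range n).filter fun k => ω ∈ E k).card : ℝ) := by
  have heq : (fun ω => (((Finset.range n).filter fun k => ω ∈ E k).card : ℝ)) =
      fun ω => ∑ k ∈ Finset.range n, (E k).indicator (1 : Ω → ℝ) ω := by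
    funext ω
    rw [Finset.card_filter, Nat.cast_sum]
    refine Finset.sum_congr rfl fun k _ => ?_
    by_cases h : ω ∈ E k
    · rw [if_pos h, Set.indicator_of_mem h]; simp
    · rw [if_neg h, Set.indicator_of_notMem h]; simp
  rw [heq]
  exact Finset.measurable_sum _ fun k hk => (measurable_const.indicator (hE k (Finset.mem_range.1 hk)))

/-- **First-moment pooling** (reverse Markov for a bounded count). Under ANY probability measure: if each of
`E_0, …, E_{n-1}` (`0 < n`) has probability `≥ β`, then with probability `≥ β/2` at least `β·n/2` of them occur
(`E[Y] = Σ μ(E_k) ≥ βn`, `Y ≤ n` ⇒ `βn ≤ n·μ(Y ≥ βn/2) + βn/2`). Replaces Kozma–Nitzan's uniqueness zone (Lemma 7)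
in the slab Step IV. [cite: KozmaNitzan2024, §4 Lemma 7 (p. 15), Lemma 10 Step IV (pp. 19–21)] -/
theorem half_le_measureReal_half_mul_le_card (μ : Measure Ω) [IsProbabilityMeasure μ] (E : ℕ → Set Ω) {n : ℕ}
    (hn : 0 < n) (hE : ∀ k < n, MeasurableSet (E k)) {β : ℝ} (hβ : ∀ k < n, β ≤ μ.real (E k)) :
    β / 2 ≤ μ.real {ω | β * n / 2 ≤ (((Finset.range n).filter fun k => ω ∈ E k).card : ℝ)} := by
  -- trivial when `β < 0`
  rcases lt_or_ge β 0 with hβ0 | hβ0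
  · exact le_trans (by linarith) measureReal_nonneg
  set Y : Ω → ℝ := fun ω => (((Finset.range n).filter fun k => ω ∈ E k).card : ℝ) with hY
  have hYm : Measurable Y := measurable_card_filter_mem E n hE
  set G : Set Ω := {ω | β * n / 2 ≤ Y ω} with hG
  have hGm : MeasurableSet G := measurableSet_le measurable_const hYm
  have hnR : (0 : ℝ) < n := by exact_mod_cast hn
  -- `Y` as a sum of indicators; `0 ≤ Y ≤ n`
  have hYsum : ∀ ω, Y ω = ∑ k ∈ Finset.range n, (E k).indicator (fun _ => (1 : ℝ)) ω := by
    intro ω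
    simp only [hY]
    rw [Finset.card_filter, Nat.cast_sum]
    refine Finset.sum_congr rfl fun k _ => ?_
    by_cases h : ω ∈ E k
    · rw [if_pos h, Set.indicator_of_mem h]; simp
    · rw [if_neg h, Set.indicator_of_notMem h]; simp
  have hYle : ∀ ω, Y ω ≤ n := by
    intro ω
    simp only [hY]
    have := Finset.card_filter_le (Finset.range n) (fun k => ω ∈ E k)
    rw [Finset.card_range] at this
    exact_mod_cast this
  have hY0 : ∀ ω, 0 ≤ Y ω := fun ω => by simp only [hY]; positivity
  have hYint : Integrable Y μ := by
    refine ⟨hYm.aestronglyMeasurable, ?_⟩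
    refine HasFiniteIntegral.of_bounded (C := (n : ℝ)) (Filter.Eventually.of_forall fun ω => ?_)
    rw [Real.norm_eq_abs, abs_of_nonneg (hY0 ω)]
    exact hYle ω
  -- `E[Y] = Σ μ(E_k) ≥ β n`
  have hEY : β * n ≤ ∫ ω, Y ω ∂μ := by
    have hint : ∫ ω, Y ω ∂μ = ∑ k ∈ Finset.range n, μ.real (E k) := by
      rw [show (fun ω => Y ω) = fun ω => ∑ k ∈ Finset.range n, (E k).indicator (fun _ => (1 : ℝ)) ω from
        funext hYsum]
      rw [integral_finsetSum (Finset.range n) (f := fun k ω => (E k).indicator (fun _ => (1 : ℝ)) ω)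
        fun k hk => (integrable_const (1 : ℝ)).indicator (hE k (Finset.mem_range.1 hk))]
      refine Finset.sum_congr rfl fun k hk => ?_
      rw [integral_indicator_const (1 : ℝ) (hE k (Finset.mem_range.1 hk)), smul_eq_mul, mul_one]
    rw [hint]
    calc β * n = ∑ _k ∈ Finset.range n, β := by rw [Finset.sum_const, Finset.card_range, nsmul_eq_mul, mul_comm]
      _ ≤ ∑ k ∈ Finset.range n, μ.real (E k) := Finset.sum_le_sum fun k hk => hβ k (Finset.mem_range.1 hk)
  -- split `E[Y]` over `G` and `Gᶜ`
  have hsplit : ∫ ω, Y ω ∂μ = ∫ ω in G, Y ω ∂μ + ∫ ω in Gᶜ, Y ω ∂μ :=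
    (integral_add_compl hGm hYint).symm
  have h1 : ∫ ω in G, Y ω ∂μ ≤ (n : ℝ) * μ.real G := by
    have h := setIntegral_mono_on hYint.integrableOn (integrableOn_const (C := (n : ℝ))) hGm
      (fun ω _ => hYle ω)
    rw [setIntegral_const, smul_eq_mul, mul_comm] at h
    exact h
  have h2 : ∫ ω in Gᶜ, Y ω ∂μ ≤ β * n / 2 := by
    have h := setIntegral_mono_on hYint.integrableOn (integrableOn_const (C := β * n / 2)) hGm.compl
      (fun ω hω => le_of_lt (not_le.1 hω))
    rw [setIntegral_const, smul_eq_mul] at h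
    have hGc1 : μ.real Gᶜ ≤ 1 := measureReal_le_one
    have hβn : 0 ≤ β * n / 2 := by positivity
    calc ∫ ω in Gᶜ, Y ω ∂μ ≤ μ.real Gᶜ * (β * n / 2) := h
      _ ≤ 1 * (β * n / 2) := mul_le_mul_of_nonneg_right hGc1 hβn
      _ = β * n / 2 := one_mul _
  have h3 : β * n ≤ n * μ.real G + β * n / 2 := by linarith
  have h4 : β / 2 * n ≤ μ.real G * n := by nlinarith
  exact le_of_mul_le_mul_right h4 hnR

end Pooling

/-- **Shell fan-out** (composition of §1–§3; replaces the uniqueness zone in the slab Step IV). `μ = fkLaw Q W q`,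
`q ≥ 1`; `P_0, …, P_{n'-1} ⊆ Q` pairwise disjoint with `lattW p ≤ W` on their inside pairs; in `P_j` a candidate relay
`u_j` and `n ≥ 1` exits `z_{j,k}`, each joined to `u_j` INSIDE `P_j` with free-law probability `≥ β`. Then with
`μ`-probability `≥ 1 - (1 - β/2)^{n'}` some `u_j` is joined inside `P_j` to at least `β·n/2` of its exits.
[cite: KozmaNitzan2024, §4 Lemma 7 (p. 15), Lemma 10 Step IV (pp. 19–21); Grimmett2006, Thm. (5.104) proof eqs. (5.113)–(5.116), Thm. (3.7), eq. (3.22)] -/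
theorem one_sub_pow_le_fkLaw_real_exists_fanOut {q : ℝ} (hq : 1 ≤ q) (p : unitInterval) (Q : Finset (Site d))
    (W : Sym2 (Site d) → unitInterval) {n' n : ℕ} (hn : 0 < n) {P : ℕ → Finset (Site d)} {u : ℕ → Site d}
    {z : ℕ → ℕ → Site d} {β : ℝ}
    (hPQ : ∀ j < n', P j ⊆ Q) (hdisj : ∀ i < n', ∀ j < n', i ≠ j → Disjoint (P i) (P j))
    (hW : ∀ j < n', ∀ e ∈ wireSet (↑(P j) : Set (Site d)), lattW d p e ≤ W e)
    (hβ : ∀ j < n', ∀ k < n, β ≤ (fkLaw (P j) (restrW (↑(P j) : Set (Site d)) (lattW d p)) q).real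
      (openConnIn (↑(P j) : Set (Site d)) (u j) (z j k))) :
    1 - (1 - β / 2) ^ n' ≤ (fkLaw Q W q).real {ω | ∃ j < n', β * n / 2 ≤
      (((Finset.range n).filter fun k => ω ∈ openConnIn (↑(P j) : Set (Site d)) (u j) (z j k)).card : ℝ)} := by
  have hq0 : 0 < q := one_pos.trans_le hq
  haveI : IsProbabilityMeasure (fkLaw Q W q) := isProbabilityMeasure_fkLaw Q W hq0
  -- the fan-out events
  set A : ℕ → Set (BondConfig (Site d)) := fun j => {ω | β * n / 2 ≤
    (((Finset.range n).filter fun k => ω ∈ openConnIn (↑(P j) : Set (Site d)) (u j) (z j k)).card : ℝ)} with hA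
  have hmeasE : ∀ j k, MeasurableSet (openConnIn (↑(P j) : Set (Site d)) (u j) (z j k)) := fun j k =>
    measurableSet_openConnIn_of_countable _ _ _
  have hAm : ∀ j < n', MeasurableSet (A j) := fun j _ =>
    measurableSet_le measurable_const (measurable_card_filter_mem _ n fun k _ => hmeasE j k)
  have hAup : ∀ j < n', IsUpperSet (A j) := by
    intro j _ ω ω' hle hω
    simp only [hA, Set.mem_setOf_eq] at hω ⊢
    refine hω.trans ?_
    exact_mod_cast Finset.card_le_card (Finset.monotone_filter_right _ fun k _ hk =>
      isUpperSet_openConnIn _ _ _ hle hk)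
  have hAdet : ∀ j < n', DeterminedBy (A j) (wireSet (↑(P j) : Set (Site d))) := by
    intro j _
    rw [determinedBy_iff]
    intro ω ω' hω
    have hk : ∀ k, ω ∈ openConnIn (↑(P j) : Set (Site d)) (u j) (z j k) ↔
        ω' ∈ openConnIn (↑(P j) : Set (Site d)) (u j) (z j k) := fun k =>
      (determinedBy_iff _ _).1 (determinedBy_openConnIn_wireSet (↑(P j) : Set (Site d)) (u j) (z j k) subset_rfl)
        ω ω' hω
    simp only [hA, Set.mem_setOf_eq]
    rw [Finset.filter_congr fun k _ => hk k]
  -- pooling in each sub-plate under its free law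
  have hα : ∀ j < n', β / 2 ≤ (fkLaw (P j) (restrW (↑(P j) : Set (Site d)) (lattW d p)) q).real (A j) := by
    intro j hj
    haveI : IsProbabilityMeasure (fkLaw (P j) (restrW (↑(P j) : Set (Site d)) (lattW d p)) q) :=
      isProbabilityMeasure_fkLaw _ _ hq0
    exact half_le_measureReal_half_mul_le_card _ (fun k => openConnIn (↑(P j) : Set (Site d)) (u j) (z j k)) hn
      (fun k _ => hmeasE j k) (fun k hk => hβ j hj k hk)
  have h := one_sub_pow_le_fkLaw_real_biUnion hq p Q W hPQ hdisj hAup hAm hAdet hW hα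
  refine h.trans (measureReal_mono (fun ω hω => ?_) (measure_ne_top _ _))
  simp only [Set.mem_iUnion, exists_prop] at hω
  obtain ⟨j, hj, hωj⟩ := hω
  exact ⟨j, hj, hωj⟩

/-- **The frozen shell under a pinned law**: under `fkLaw Λ (pinW W F ξ) q` (`q ≥ 1`, `F` a finite pair set of `Λ`)
the configuration agrees with `ξ` on `F` a.s. ((N) of the pinning API), so `B ∩ [ξ]_F ⊆ A ⇒ φ(B) ≤ φ(A)` (slab Step
IV: `B` = lane event, `[ξ]_F` = frozen-open shell path relay → exit, `A` = `{u ↔ T in D}`).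
[cite: Grimmett2006, Thm. (3.7) (p. 39); KozmaNitzan2024, §4 p. 21 (the graphs K_ξ)] -/
theorem fkLaw_pinW_real_le_of_inter_localCylinder_subset (Λ : Finset (Site d)) {q : ℝ} (hq : 1 ≤ q)
    (W : Sym2 (Site d) → unitInterval) {F : Finset (Sym2 (Site d))}
    (hF : (↑F : Set (Sym2 (Site d))) ⊆ Set.range (Sym2.map (Subtype.val : ↥Λ → Site d)))
    (ξ : Set (Sym2 (Site d))) {A B : Set (BondConfig (Site d))}
    (h : B ∩ localCylinder (↑F : Set (Sym2 (Site d))) ξ ⊆ A) :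
    (fkLaw Λ (pinW W ↑F ξ) q).real B ≤ (fkLaw Λ (pinW W ↑F ξ) q).real A := by
  have hL := isPinningLaw_fkLaw Λ hq
  haveI := hL.prob (pinW W ↑F ξ)
  set N := localCylinder (↑F : Set (Sym2 (Site d))) ξ with hN
  have hN0 : (fkLaw Λ (pinW W ↑F ξ) q).real Nᶜ = 0 :=
    hL.null (pinW W ↑F ξ) ↑F ξ hF (F.finite_toSet.countable)
      (fun e he hξ => pinW_apply_of_mem_of_mem W he hξ) (fun e he hξ => pinW_apply_of_mem_of_not_mem W he hξ)
  have hNm : MeasurableSet N := measurableSet_localCylinder F.finite_toSet.countable _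
  calc (fkLaw Λ (pinW W ↑F ξ) q).real B
      ≤ (fkLaw Λ (pinW W ↑F ξ) q).real ((B ∩ N) ∪ Nᶜ) :=
        measureReal_mono (fun ω hω => by
          by_cases hωN : ω ∈ N
          · exact Or.inl ⟨hω, hωN⟩
          · exact Or.inr hωN) (measure_ne_top _ _)
    _ ≤ (fkLaw Λ (pinW W ↑F ξ) q).real (B ∩ N) + (fkLaw Λ (pinW W ↑F ξ) q).real Nᶜ :=
        measureReal_union_le (μ := fkLaw Λ (pinW W ↑F ξ) q) _ _
    _ ≤ (fkLaw Λ (pinW W ↑F ξ) q).real A := by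
        rw [hN0, add_zero]
        exact measureReal_mono (μ := fkLaw Λ (pinW W ↑F ξ) q) h (measure_ne_top _ _)

end Summit.CriticalPhenomena.PercolationContinuityZ3.Theorems.FK

end
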